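import Summits.AtomisticToContinuum.Crystallization.Theorems.OverbindingBudgetEnergyPinningCut
import Summits.AtomisticToContinuum.Crystallization.Theorems.PhononSlackCertificatesNearFarGlueRHcpBoxSubset

/-!
# OverbindingBudget · decomp-a2c lens-4 g34 — part XXII-C: the energy leaf E1 `SiteEnergyFloorStrains` PROVED

Helper file under `--supports stmt-AtomisticToContinuum-31280` (RDEF = `Theses.OverbindingBudget.RobustDefectLimitWindows`); closes nothing.

E1 of part XXII-B (`OverbindingBudgetEnergyPinningCut.SiteEnergyFloorStrains e₁`) is a THEOREM for every `e₁`
(`siteEnergyFloorStrains_holds`): a `9/10`-covering texture `Y` with separation `≥ 9/10` whose mean half site energy on large cubes is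
`≥ e₁ + κ′` (`κ′ > 0`), where `E(N) ≤ (e₁ + ε)N` eventually for every `ε > 0`, has strained cubes with `κ = κ′/128`.  Proof:
* at separation `≥ 9/10 > 2^{-1/6}` every Lennard-Jones pair term is `≤ 0` (`PhononSlackCertificatesNearFarGlueR.lennardJones_nonpos_of_ge_nine_tenths`,
  reused), so a site's full
  field `siteEnergy Y y` (a `tsum` over `Y ∖ {y}`, summable by uniform discreteness) is at most its finite part over the chunk
  (`siteEnergy_le_sum`, via `OverbindingBudgetCubeBookkeeping.stub_siteSumSplit` and `tsum_nonpos`); hence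
  `½ Σ_{y,w ∈ F} V ≥ Σ_{y ∈ F} siteEnergy Y y / 2 ≥ (e₁ + κ′)·#F` on every large cube chunk `F`;
* the cube `Q(0, 2m+3)` contains `≥ m³` points of `Y` (`OverbindingBudgetElasticSplitLocalVirial.le_card_deep`, the `2`-grid/covering
  injection), so `#F ≥ m³ ≥ ℓ³/64` and `#F → ∞`;
* `E(#F) ≤ (e₁ + κ′/2)·#F` for `#F` large (the trial bound), so `E(#F) + (κ′/128)ℓ³ ≤ E(#F) + (κ′/2)·#F ≤ (e₁ + κ′)·#F ≤ ½ ΣΣ V`.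
Consequently the energy cut of ★ `StackedCellPinningU` has TWO certificate leaves and one known leaf:
★ ⟸ `EnergyTrialBound e₁` ∧ E2T ∧ E2S (`stackedCellPinningU_of_cellEnergy`), and the cones XXIV `rdef_twentyfourth_of_recordK_energy[_ref]`
(= XXIII with E1 discharged) are PROVED.
-/

noncomputable section

namespace Summit.AtomisticToContinuum.Crystallization.Theorems.OverbindingBudgetEnergyPinningFloor

open Metric
open Literature.MathematicalPhysics.StatisticalMechanics (lennardJones lennardJones_zero groundStateEnergy UniformlyDiscrete)
open Summit.AtomisticToContinuum.Crystallization.Theorems.PhononSlackCertificatesNearFarGlueR (lennardJones_nonpos_of_ge_nine_tenths)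
open Summit.AtomisticToContinuum.Crystallization.Theses.OverbindingBudget (RobustDefectLimitWindows)
open Summit.AtomisticToContinuum.Crystallization.Theses.PricedLinkCensus (ChargedEnergyGap)
open Summit.AtomisticToContinuum.Crystallization.Theorems.OverbindingBudgetGradedBareness (CleanlessExcessT)
open Summit.AtomisticToContinuum.Crystallization.Theorems.OverbindingBudgetCoherentCut (CoherentResidual)
open Summit.AtomisticToContinuum.Crystallization.Theorems.OverbindingBudgetUniformCutStatements (GrossCleanBallsU)
open Summit.AtomisticToContinuum.Crystallization.Theorems.OverbindingBudgetEdgeRelaxationStatements (StrainedCubes)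
open Summit.AtomisticToContinuum.Crystallization.Theorems.OverbindingBudgetElasticSplitScale (CompressedVirialLaw)
open Summit.AtomisticToContinuum.Crystallization.Theorems.OverbindingBudgetExcessInstability (finite_inter_cube)
open Summit.AtomisticToContinuum.Crystallization.Theorems.OverbindingBudgetElasticSplitLocalVirial (le_card_deep)
open Summit.AtomisticToContinuum.Crystallization.Theorems.OverbindingBudgetCubeBookkeeping (stub_siteSumSplit)
open Summit.AtomisticToContinuum.Crystallization.Theorems.ChartedPlanarOrderChunkFloor (E3)
open Summit.AtomisticToContinuum.Crystallization.Theorems.ChartedPlanarOrderDensityDichotomy (IsSep)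
open Summit.AtomisticToContinuum.Crystallization.Theorems.ChartedPlanarOrderTubeConvex (TubeConvexW' TubeConvexRef)
open Summit.AtomisticToContinuum.Crystallization.Theorems.OverbindingBudgetScaleWidening (DoorPeriodicW)
open Summit.AtomisticToContinuum.Crystallization.Theorems.OverbindingBudgetTwoShellShape (TwoShellShape BarlowGluingW)
open Summit.AtomisticToContinuum.Crystallization.Theorems.OverbindingBudgetStackedRigidityW (StackedReductionW GapStressVanishesW)
open Summit.AtomisticToContinuum.Crystallization.Theorems.OverbindingBudgetStackedRigidityRef (RegistryPinningW)
open Summit.AtomisticToContinuum.Crystallization.Theorems.OverbindingBudgetRegistryCut (RegistryResidual RegistryTube RegistryMetric)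
open Summit.AtomisticToContinuum.Crystallization.Theorems.OverbindingBudgetRegistryDichotomy (RegistryGeometryW BalancedLocus
  SqRegistryGeometryW SqBalancedHeight SqRegistryMetric)
open Summit.AtomisticToContinuum.Crystallization.Theorems.OverbindingBudgetRegistryDichotomyCW (RegistryMetricCW SqRegistryMetricCW)
open Summit.AtomisticToContinuum.Crystallization.Theorems.OverbindingBudgetEnergyPinning (StackedCellPinningU)
open Summit.AtomisticToContinuum.Crystallization.Theorems.OverbindingBudgetEnergyPinningCut (siteEnergy EnergyTrialBound
  MeanSiteEnergyFloor SiteEnergyFloorStrains StrainedCellEnergyT StrainedCellEnergyS stackedCellPinningU_of_energy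
  rdef_twentythird_of_recordK_energy rdef_twentythird_of_recordK_energy_ref)

/-! ## §1 A site's field is at most its chunk part (attractive pairs at separation `≥ 9/10`: `PhononSlackCertificatesNearFarGlueR.lennardJones_nonpos_of_ge_nine_tenths`) -/

/-- **A site's full field is at most its part over a chunk containing the site** (separation `≥ 9/10`: the dropped terms are `≤ 0`):
`siteEnergy Y y ≤ Σ_{w ∈ F} V_LJ(dist y w)` for `F ⊆ Y` finite, `y ∈ F` (diagonal term `V_LJ(0) = 0`). [this file] -/
theorem siteEnergy_le_sum {δ : ℝ} (hδ : 9 / 10 ≤ δ) {Y : Set E3} (hsep : IsSep δ Y) (F : Finset E3) (hFY : (↑F : Set E3) ⊆ Y)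
    {y : E3} (hy : y ∈ F) : siteEnergy Y y ≤ ∑ w ∈ F, lennardJones (dist y w) := by
  classical
  have hδ0 : (0 : ℝ) < δ := by linarith
  have hUD' : UniformlyDiscrete (Y \ {y}) := ⟨δ, hδ0, fun x hx z hz hxz => hsep x hx.1 z hz.1 hxz⟩
  have hF'Y : (↑(F.erase y) : Set E3) ⊆ Y \ {y} := by
    intro z hz
    rw [Finset.coe_erase] at hz
    exact ⟨hFY hz.1, hz.2⟩
  have hsplit := stub_siteSumSplit (Y \ {y}) hUD' (F.erase y) hF'Y y
  have hyY : y ∈ Y := hFY (Finset.mem_coe.2 hy)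
  have htail : ∑' w : ↥((Y \ {y}) \ ↑(F.erase y)), lennardJones (dist y (w : E3)) ≤ 0 := by
    refine tsum_nonpos fun w => lennardJones_nonpos_of_ge_nine_tenths ?_
    have hwY : (w : E3) ∈ Y := w.2.1.1
    have hne : (w : E3) ≠ y := fun h => w.2.1.2 (Set.mem_singleton_iff.2 h)
    exact hδ.trans (hsep y hyY w hwY (Ne.symm hne))
  have hE : siteEnergy Y y = ∑' w : ↥(Y \ {y}), lennardJones (dist y (w : E3)) := rfl
  have herase : ∑ w ∈ F, lennardJones (dist y w) = ∑ w ∈ F.erase y, lennardJones (dist y w) := by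
    rw [← Finset.add_sum_erase F _ hy, dist_self, lennardJones_zero, zero_add]
  rw [hE, hsplit, herase]
  linarith

/-! ## §2 E1 is a theorem -/

/-- ★ **E1 PROVED: `SiteEnergyFloorStrains e₁` for every `e₁`** (with `κ = κ′/128`; cube `Q(0, 2m+3)`, `m → ∞`). [this file] -/
theorem siteEnergyFloorStrains_holds (e₁ : ℝ) : SiteEnergyFloorStrains e₁ := by
  classical
  intro κ' hκ' δ hδ Y hsep hcov hTr hM
  obtain ⟨ℓ₁, hℓ₁⟩ := hM
  have hδ0 : (0 : ℝ) < δ := by linarith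
  have hUD : UniformlyDiscrete Y := ⟨δ, hδ0, hsep⟩
  obtain ⟨N₁, hN₁⟩ := Filter.eventually_atTop.1 (hTr (κ' / 2) (by linarith))
  refine ⟨κ' / 128, by positivity, fun ℓ₀ => ?_⟩
  obtain ⟨m, hm⟩ := exists_nat_ge (max (max ℓ₀ ℓ₁) ((N₁ : ℝ) + 2))
  have hmℓ₀ : ℓ₀ ≤ m := (le_max_left _ _).trans ((le_max_left _ _).trans hm)
  have hmℓ₁ : ℓ₁ ≤ m := (le_max_right _ _).trans ((le_max_left _ _).trans hm)
  have hmN : (N₁ : ℝ) + 2 ≤ m := (le_max_right _ _).trans hm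
  have hN0 : (0 : ℝ) ≤ N₁ := Nat.cast_nonneg _
  have hm2 : (2 : ℝ) ≤ m := by linarith
  refine ⟨2 * (m : ℝ) + 3, by linarith, 0, ?_⟩
  have hℓ0 : (0 : ℝ) ≤ 2 * (m : ℝ) + 3 := by positivity
  have hfin := finite_inter_cube hUD (0 : E3) hℓ0
  refine ⟨hfin.toFinset, hfin.coe_toFinset, ?_⟩
  set F : Finset E3 := hfin.toFinset with hFdef
  have hmemF : ∀ z, z ∈ F ↔ z ∈ Y ∧ ∀ i : Fin 3, (0 : E3) i ≤ z i ∧ z i < (0 : E3) i + (2 * (m : ℝ) + 3) :=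
    fun z => by rw [hFdef, Set.Finite.mem_toFinset]; rfl
  have hFY : (↑F : Set E3) ⊆ Y := fun z hz => ((hmemF z).1 hz).1
  -- counting: `m³ ≤ #F`, hence `N₁ ≤ #F` and `ℓ³ ≤ 64·#F`
  have hdeep := le_card_deep hcov (0 : E3) m F (fun z hz hzc => (hmemF z).2 ⟨hz, hzc⟩)
  have hcard : (m : ℝ) ^ 3 ≤ F.card := hdeep.trans (by exact_mod_cast Finset.card_filter_le _ _)
  have hmm : (4 : ℝ) ≤ (m : ℝ) * m := by nlinarith
  have hm3 : (m : ℝ) ≤ (m : ℝ) ^ 3 := by nlinarith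
  have hFN : N₁ ≤ F.card := by
    have h : (N₁ : ℝ) ≤ F.card := by linarith
    exact_mod_cast h
  have hvol : (2 * (m : ℝ) + 3) ^ 3 ≤ 64 * F.card := by
    have h1 : 2 * (m : ℝ) + 3 ≤ 4 * m := by linarith
    have h2 : (2 * (m : ℝ) + 3) ^ 3 ≤ (4 * (m : ℝ)) ^ 3 := by gcongr
    nlinarith
  have hκvol : κ' / 128 * (2 * (m : ℝ) + 3) ^ 3 ≤ κ' / 2 * F.card :=
    calc κ' / 128 * (2 * (m : ℝ) + 3) ^ 3 ≤ κ' / 128 * (64 * F.card) := mul_le_mul_of_nonneg_left hvol (by positivity)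
      _ = κ' / 2 * F.card := by ring
  -- energies: trial bound, mean floor, site fields below chunk sums
  have hE : groundStateEnergy lennardJones 3 F.card ≤ (e₁ + κ' / 2) * F.card := hN₁ _ hFN
  have hmean : (e₁ + κ') * F.card ≤ ∑ y ∈ F, siteEnergy Y y / 2 :=
    hℓ₁ (2 * (m : ℝ) + 3) (by linarith) 0 F hfin.coe_toFinset
  have hsum : ∑ y ∈ F, siteEnergy Y y / 2 ≤ 1 / 2 * ∑ y ∈ F, ∑ w ∈ F, lennardJones (dist y w) := by
    rw [Finset.mul_sum]
    exact Finset.sum_le_sum fun y hy => by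
      have h := siteEnergy_le_sum hδ hsep F hFY hy
      linarith
  linarith

/-! ## §3 The energy cut with E1 discharged, and the cones -/

/-- ★ **the energy seam with E1 discharged.** `EnergyTrialBound e₁ → StrainedCellEnergyT Λ₁ s₁ s₂ (e₁ + κ′) → StrainedCellEnergyS Λ₁ t₁ t₂ (e₁ + κ′)
→ StackedCellPinningU Λ₁ s₁ s₂ t₁ t₂` for `0 < κ′`, `Λ₁ ≤ 17/16`. [this file] -/
theorem stackedCellPinningU_of_cellEnergy {Λ₁ s₁ s₂ t₁ t₂ e₁ κ' : ℝ} (hκ' : 0 < κ') (hΛ₁ : Λ₁ ≤ 17 / 16) (hTr : EnergyTrialBound e₁)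
    (hT : StrainedCellEnergyT Λ₁ s₁ s₂ (e₁ + κ')) (hS : StrainedCellEnergyS Λ₁ t₁ t₂ (e₁ + κ')) : StackedCellPinningU Λ₁ s₁ s₂ t₁ t₂ :=
  stackedCellPinningU_of_energy hκ' hΛ₁ (siteEnergyFloorStrains_holds e₁) hTr hT hS

/-- ★ **RDEF cone, TWENTY-FOURTH form at the numbers of record: ENERGY PINNING with E1 discharged** (W′ currency): the energy leaves are
`EnergyTrialBound e₁` [KNOWN at `e₁ = −7175/10000`] ∧ E2T `StrainedCellEnergyT (17/16) s₁ s₂ (e₁ + κ′)` ∧ E2S `StrainedCellEnergyS (17/16) t₁ t₂ (e₁ + κ′)`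
[CERT·M]. [this file] -/
theorem rdef_twentyfourth_of_recordK_energy (s₁ s₂ t₁ t₂ h₀ h₁ e₁ κ' : ℝ) (hκ' : 0 < κ') (hG : GrossCleanBallsU (1 / 250) 10)
    (hCEG : ChargedEnergyGap) (hC : CompressedVirialLaw (1 / 250) 10) (hS : TwoShellShape (1 / 100) (3 / 50) (1 / 450)) (hB₂ : BarlowGluingW)
    (hD : DoorPeriodicW 2) (hSR : StackedReductionW 2 (17 / 16)) (hV : GapStressVanishesW (17 / 16))
    (hP : RegistryPinningW (17 / 16) (1 / 40) (3 / 16)) (hT : TubeConvexW' (17 / 16) (1 / 40)) (hTr : EnergyTrialBound e₁)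
    (hET : StrainedCellEnergyT (17 / 16) s₁ s₂ (e₁ + κ')) (hES : StrainedCellEnergyS (17 / 16) t₁ t₂ (e₁ + κ'))
    (hGeo : RegistryGeometryW (17 / 16) s₁ s₂ h₀ (3 / 20)) (hBal : BalancedLocus s₁ s₂ h₀ (1 / 40)) (hR1 : RegistryResidual s₁ s₂ (1 / 250))
    (hR2 : RegistryTube s₁ s₂ (1 / 100) 1) (hMet : RegistryMetric s₁ s₂ (3 / 500)) (hSqGeo : SqRegistryGeometryW (17 / 16) t₁ t₂ h₁ (3 / 20))
    (hSqH : SqBalancedHeight t₁ t₂ h₁ (1 / 100)) (hSqMet : SqRegistryMetric t₁ t₂ h₁ (1 / 100) 0) (hCE : CleanlessExcessT)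
    (hRes : CoherentResidual 10) : RobustDefectLimitWindows :=
  rdef_twentythird_of_recordK_energy s₁ s₂ t₁ t₂ h₀ h₁ e₁ κ' hκ' hG hCEG hC hS hB₂ hD hSR hV hP hT (siteEnergyFloorStrains_holds e₁) hTr hET hES
    hGeo hBal hR1 hR2 hMet hSqGeo hSqH hSqMet hCE hRes

/-- ★ **RDEF cone, twenty-fourth form at the numbers of record, reference-centred (CURRENCY OF RECORD): ENERGY PINNING with E1 discharged.**
[this file] -/
theorem rdef_twentyfourth_of_recordK_energy_ref (s₁ s₂ t₁ t₂ h₀ h₁ e₁ κ' : ℝ) (hκ' : 0 < κ') (hG : GrossCleanBallsU (1 / 250) 10)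
    (hCEG : ChargedEnergyGap) (hC : CompressedVirialLaw (1 / 250) 10) (hS : TwoShellShape (1 / 100) (3 / 50) (1 / 450)) (hB₂ : BarlowGluingW)
    (hD : DoorPeriodicW 2) (hSR : StackedReductionW 2 (17 / 16)) (hV : GapStressVanishesW (17 / 16))
    (hP : RegistryPinningW (17 / 16) (1 / 40) (3 / 16)) (hT : TubeConvexRef (17 / 16) (1 / 40)) (hTr : EnergyTrialBound e₁)
    (hET : StrainedCellEnergyT (17 / 16) s₁ s₂ (e₁ + κ')) (hES : StrainedCellEnergyS (17 / 16) t₁ t₂ (e₁ + κ'))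
    (hGeo : RegistryGeometryW (17 / 16) s₁ s₂ h₀ (3 / 20)) (hBal : BalancedLocus s₁ s₂ h₀ (1 / 40)) (hR1 : RegistryResidual s₁ s₂ (1 / 250))
    (hR2 : RegistryTube s₁ s₂ (1 / 100) 1) (hMet : RegistryMetricCW s₁ s₂ (3 / 500))
    (hSqGeo : SqRegistryGeometryW (17 / 16) t₁ t₂ h₁ (3 / 20)) (hSqH : SqBalancedHeight t₁ t₂ h₁ (1 / 100))
    (hSqMet : SqRegistryMetricCW t₁ t₂ h₁ (1 / 100) 0) (hCE : CleanlessExcessT) (hRes : CoherentResidual 10) : RobustDefectLimitWindows :=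
  rdef_twentythird_of_recordK_energy_ref s₁ s₂ t₁ t₂ h₀ h₁ e₁ κ' hκ' hG hCEG hC hS hB₂ hD hSR hV hP hT (siteEnergyFloorStrains_holds e₁) hTr hET
    hES hGeo hBal hR1 hR2 hMet hSqGeo hSqH hSqMet hCE hRes

end Summit.AtomisticToContinuum.Crystallization.Theorems.OverbindingBudgetEnergyPinningFloor

end
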